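import Literature.MathematicalPhysics.QuantumLattice.HubbardOpenBoxCodedClusterRows
import Literature.MathematicalPhysics.QuantumLattice.HubbardOpenBoxEDUpperCertificate
import HarnessLib

/-!
# Sparse coded cluster vectors: exact Rayleigh traces over a coded cluster oracle

Topic `MathematicalPhysics/QuantumLattice`, family `hubbard`. Companion of the generic data-free floor chain
(`HubbardOpenBoxCodedClusterRows`, `…Certificate`, `…CertificateBlocks`) on the UPPER (variational) side, and the
sparse generalisation of `HubbardOpenBoxEDUpperCertificate` (which sums over all `4^{ab}` occupation codes — out of
reach for a twelve-site cluster). A cluster vector is supplied as a binary SEARCH TREE `CoefTree` of integer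
coefficients addressed by occupation codes (Lin–Gubernatis 1993 §II: vectors addressed by bit codes, the Hamiltonian
applied on the fly); the coefficient of a code is read in `O(log n)` comparisons (`CoefTree.get`) and every sum is a
recursion on the tree, so the kernel never walks `4^{ab}` codes and needs no packed rank table.

* §1 `CoefTree`, `get`, `sumBy`, `keys`, the kernel checks `isBST lo hi` (search-tree order, keys in `[lo, hi)`) and
  `allKeys P` (semantics: `get = 0` off the keys; a tree sum is the sum over the key set).
* §2 on the open `a × b` box: the vector `T.vec = codedVec T.get`, the reindexing of Fock-space sums to the key set
  (`sum_univ_mul_eq_sum_keys`), and, for ANY coded cluster oracle `O` with `O.Models a b hz Q H`, the exact quadratic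
  form **`star_vec_dotProduct_mulVec`**: `⟨φ_T, H φ_T⟩ = T.sApp O / Q` with the computable integer
  `T.sApp O = Σ_keys v·(O.app k T.get)`; the exact pair products `star_vec_dotProduct_vec` (`= T.dot U`), and
  `isNParticle_vec` from a key check.
* §3 the normalised vectors `T.unit = T.vec/‖T.vec‖`: `star_unit_dotProduct_unit = 1`, `… = 0` from `T.dot U = 0`,
  **`re_star_unit_dotProduct_mulVec_unit`**: `Re⟨T.unit, H T.unit⟩ = T.sApp O/(Q·T.nn)` — a RATIONAL trace although the
  unit vector is irrational — `isNParticle_unit`, and **`orthonormal_units`**: a family of checked trees with vanishing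
  pair products is exactly orthonormal (the hypothesis shape of Rayleigh-family floors / Peierls bounds,
  `le_emeryCellPressure_of_rayleighFamily`, `le_sq_mul_gcPressureTT'Zeeman_of_rayleighFamily`) while its traces are the
  exact rationals the cluster variational principles consume (`energyDensityTT'_le_of_openBox_witness_planes`,
  `emeryEnergyDensity_le_block2x2_rayleigh`). [cite: Ruelle1969, §3.3]

Everything is proved; no named fact; nothing numerical is asserted here.

## References

* H. Q. Lin, J. E. Gubernatis, Comput. Phys. 7 (1993) 400, §II (bit-coded bases; on-the-fly application).
  [cite: LinGubernatis1993, §II]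
* D. Ruelle, *Statistical Mechanics: Rigorous Results* (1969), §3.3 (cluster trial states). [cite: Ruelle1969, §3.3]
-/

namespace Literature.MathematicalPhysics.QuantumLattice

namespace OccupationCode

open Finset Matrix

/-! ### §1 Coefficient search trees -/

/-- **A sparse integer cluster vector**: a binary search tree over occupation codes carrying integer coefficients
(`nil` = the zero vector). [cite: LinGubernatis1993, §II] -/
inductive CoefTree : Type where
  | nil : CoefTree
  | node (l : CoefTree) (k : ℕ) (v : ℤ) (r : CoefTree) : CoefTree

namespace CoefTree

/-- The coefficient of the code `m` (search-tree descent; `0` off the keys). [cite: LinGubernatis1993, §II] -/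
def get : CoefTree → ℕ → ℤ
  | nil, _ => 0
  | node l k v r, m => if m < k then get l m else if m = k then v else get r m

/-- The tree sum `Σ_nodes g(key, coefficient)` (recursion on the tree). [cite: LinGubernatis1993, §II] -/
def sumBy (g : ℕ → ℤ → ℤ) : CoefTree → ℤ
  | nil => 0
  | node l k v r => sumBy g l + g k v + sumBy g r

/-- The keys in symmetric order. [folklore] -/
def keys : CoefTree → List ℕ
  | nil => []
  | node l k _ r => keys l ++ k :: keys r

/-- **Kernel check of the search-tree order**: every key lies in `[kl, kh)`, left keys below and right keys above the
node key. [folklore] -/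
def isBST : CoefTree → ℕ → ℕ → Bool
  | nil, _, _ => true
  | node l k _ r, kl, kh => decide (kl ≤ k) && decide (k < kh) && isBST l kl k && isBST r (k + 1) kh

/-- Kernel check of a predicate on every key. [folklore] -/
def allKeys (P : ℕ → Bool) : CoefTree → Bool
  | nil => true
  | node l k _ r => P k && allKeys P l && allKeys P r

/-- Keys of a checked tree lie in its window. [folklore] -/
private theorem mem_keys_bounds : ∀ {T : CoefTree} {kl kh : ℕ}, T.isBST kl kh = true → ∀ m ∈ T.keys, kl ≤ m ∧ m < kh
  | nil, _, _, _, m, hm => by simp [keys] at hm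
  | node l k v r, kl, kh, h, m, hm => by
      simp only [isBST, Bool.and_eq_true, decide_eq_true_eq] at h
      obtain ⟨⟨⟨h1, h2⟩, hl⟩, hr⟩ := h
      simp only [keys, List.mem_append, List.mem_cons] at hm
      rcases hm with hm | rfl | hm
      · have := mem_keys_bounds hl m hm; omega
      · exact ⟨h1, h2⟩
      · have := mem_keys_bounds hr m hm; omega

/-- Off the keys the coefficient vanishes (any tree). [folklore] -/
private theorem get_eq_zero_of_not_mem : ∀ {T : CoefTree} {m : ℕ}, m ∉ T.keys → T.get m = 0
  | nil, _, _ => rfl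
  | node l k v r, m, hm => by
      simp only [keys, List.mem_append, List.mem_cons, not_or] at hm
      obtain ⟨hl, hk, hr⟩ := hm
      simp only [get]
      split_ifs
      · exact get_eq_zero_of_not_mem hl
      · exact get_eq_zero_of_not_mem hr

/-- **A tree sum is the sum over the key set** (checked trees). [folklore] -/
private theorem sumBy_eq_sum (g : ℕ → ℤ → ℤ) : ∀ {T : CoefTree} {kl kh : ℕ}, T.isBST kl kh = true →
    T.sumBy g = ∑ m ∈ T.keys.toFinset, g m (T.get m)
  | nil, _, _, _ => by simp [sumBy, keys]
  | node l k v r, kl, kh, h => by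
      have hb := mem_keys_bounds h
      simp only [isBST, Bool.and_eq_true, decide_eq_true_eq] at h
      obtain ⟨⟨⟨h1, h2⟩, hl⟩, hr⟩ := h
      have hbl := mem_keys_bounds hl
      have hbr := mem_keys_bounds hr
      have hkl : k ∉ l.keys.toFinset := fun hk => by have := hbl k (List.mem_toFinset.1 hk); omega
      have hkr : k ∉ r.keys.toFinset := fun hk => by have := hbr k (List.mem_toFinset.1 hk); omega
      have hdisj : Disjoint l.keys.toFinset (insert k r.keys.toFinset) := by
        rw [Finset.disjoint_left]
        intro m hm hm'
        have h3 := hbl m (List.mem_toFinset.1 hm)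
        rcases Finset.mem_insert.1 hm' with rfl | hm'
        · omega
        · have := hbr m (List.mem_toFinset.1 hm'); omega
      have hset : (node l k v r).keys.toFinset = l.keys.toFinset ∪ insert k r.keys.toFinset := by
        simp [keys, List.toFinset_append, List.toFinset_cons]
      rw [hset, Finset.sum_union hdisj, Finset.sum_insert hkr, sumBy, sumBy_eq_sum g hl, sumBy_eq_sum g hr]
      have el : ∀ m ∈ l.keys.toFinset, g m (l.get m) = g m ((node l k v r).get m) := by
        intro m hm
        have := hbl m (List.mem_toFinset.1 hm)
        simp only [get, if_pos this.2]
      have er : ∀ m ∈ r.keys.toFinset, g m (r.get m) = g m ((node l k v r).get m) := by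
        intro m hm
        have := hbr m (List.mem_toFinset.1 hm)
        simp only [get, if_neg (show ¬ m < k by omega), if_neg (show m ≠ k by omega)]
      have ek : (node l k v r).get k = v := by simp [get]
      rw [Finset.sum_congr rfl el, Finset.sum_congr rfl er, ek]
      ring

/-- Semantics of `allKeys`. [folklore] -/
private theorem allKeys_spec {P : ℕ → Bool} : ∀ {T : CoefTree}, T.allKeys P = true → ∀ m ∈ T.keys, P m = true
  | nil, _, m, hm => by simp [keys] at hm
  | node l k v r, h, m, hm => by
      simp only [allKeys, Bool.and_eq_true] at h
      simp only [keys, List.mem_append, List.mem_cons] at hm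
      rcases hm with hm | rfl | hm
      · exact allKeys_spec h.1.2 m hm
      · exact h.1.1
      · exact allKeys_spec h.2 m hm

/-- **The integer quadratic form of an oracle**: `Σ_keys v_k · (O.app k T.get)` (`= Q·⟨φ_T, H φ_T⟩`, §2).
[cite: LinGubernatis1993, §II] -/
def sApp (T : CoefTree) (O : CodedCluster) : ℤ := T.sumBy fun k v => v * O.app k T.get

/-- **The integer pair product** `Σ_keys v_k · U.get k` (`= ⟨φ_T, φ_U⟩`, §2). [cite: LinGubernatis1993, §II] -/
def dot (T U : CoefTree) : ℤ := T.sumBy fun k v => v * U.get k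

/-- The squared norm `‖φ_T‖² = T.dot T`. [cite: LinGubernatis1993, §II] -/
def nn (T : CoefTree) : ℤ := T.dot T

/-! ### §2 The coded vector of a tree on the open box and its exact quadratic forms -/

section Box

variable {a b : ℕ}

/-- **The cluster vector of the tree**: `φ_T s = T.get (code s)`. [cite: LinGubernatis1993, §II] -/
def vec (T : CoefTree) : Fock (Orb (Fin a ×ₗ Fin b)) := codedVec T.get

/-- Entries of the tree vector. [cite: LinGubernatis1993, §II] -/
theorem vec_apply (T : CoefTree) (s : Finset (Orb (Fin a ×ₗ Fin b))) : (T.vec s : ℂ) = ((T.get (code s) : ℤ) : ℂ) := rfl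

/-- **Reindexing a Fock-space sum weighted by the tree's coefficients to the key set** (checked tree, keys `< 4^{ab}`).
[cite: LinGubernatis1993, §II] -/
theorem sum_univ_mul_eq_sum_keys {T : CoefTree} (hB : T.isBST 0 (4 ^ (a * b)) = true) (X : ℕ → ℂ) :
    ∑ s : Finset (Orb (Fin a ×ₗ Fin b)), ((T.get (code s) : ℤ) : ℂ) * X (code s) =
      ∑ m ∈ T.keys.toFinset, ((T.get m : ℤ) : ℂ) * X m := by
  refine (sum_univ_code (a := a) (b := b) (fun m => ((T.get m : ℤ) : ℂ) * X m)).trans ?_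
  rw [sumNat_eq]
  symm
  refine Finset.sum_subset (fun m hm => ?_) (fun m _ hm => ?_)
  · exact Finset.mem_range.2 (mem_keys_bounds hB m (List.mem_toFinset.1 hm)).2
  · rw [get_eq_zero_of_not_mem (fun h => hm (List.mem_toFinset.2 h))]
    simp

/-- **THE EXACT QUADRATIC FORM OF A CODED CLUSTER ORACLE on a tree vector**: if `O.Models a b hz Q H` then
`⟨φ_T, H φ_T⟩ = T.sApp O / Q`. [cite: LinGubernatis1993, §II] -/
theorem star_vec_dotProduct_mulVec {O : CodedCluster} {hz : ℕ → ℕ → ℤ} {Q : ℕ}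
    {H : Matrix (Finset (Orb (Fin a ×ₗ Fin b))) (Finset (Orb (Fin a ×ₗ Fin b))) ℂ} (hM : O.Models a b hz Q H)
    {T : CoefTree} (hB : T.isBST 0 (4 ^ (a * b)) = true) :
    star (T.vec : Fock (Orb (Fin a ×ₗ Fin b))) ⬝ᵥ (H *ᵥ T.vec) = (((T.sApp O : ℤ) : ℝ) : ℂ) / ((Q : ℝ) : ℂ) := by
  rw [dotProduct]
  have hterm : ∀ s : Finset (Orb (Fin a ×ₗ Fin b)), star (T.vec s : ℂ) * (H *ᵥ T.vec) s =
      ((T.get (code s) : ℤ) : ℂ) * ((fun m => (((O.app m T.get : ℤ) : ℝ) : ℂ) / ((Q : ℝ) : ℂ)) (code s)) := by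
    intro s
    rw [vec, hM.mulVec_eq, codedVec]
    simp only [RCLike.star_def, map_intCast]
  simp only [Pi.star_apply]
  simp_rw [hterm]
  refine (sum_univ_mul_eq_sum_keys hB (fun m => (((O.app m T.get : ℤ) : ℝ) : ℂ) / ((Q : ℝ) : ℂ))).trans ?_
  rw [sApp, sumBy_eq_sum _ hB]
  push_cast
  rw [Finset.sum_div]
  refine Finset.sum_congr rfl fun m _ => ?_
  ring

/-- **The exact pair product of two tree vectors**: `⟨φ_T, φ_U⟩ = T.dot U`. [cite: LinGubernatis1993, §II] -/
theorem star_vec_dotProduct_vec {T : CoefTree} (hB : T.isBST 0 (4 ^ (a * b)) = true) (U : CoefTree) :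
    star (T.vec : Fock (Orb (Fin a ×ₗ Fin b))) ⬝ᵥ U.vec = ((T.dot U : ℤ) : ℂ) := by
  rw [dotProduct]
  have hterm : ∀ s : Finset (Orb (Fin a ×ₗ Fin b)), star (T.vec s : ℂ) * (U.vec s : ℂ) =
      ((T.get (code s) : ℤ) : ℂ) * ((fun m => ((U.get m : ℤ) : ℂ)) (code s)) := by
    intro s
    simp only [vec_apply, RCLike.star_def, map_intCast]
  simp only [Pi.star_apply]
  simp_rw [hterm]
  refine (sum_univ_mul_eq_sum_keys hB (fun m => ((U.get m : ℤ) : ℂ))).trans ?_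
  rw [dot, sumBy_eq_sum _ hB, Int.cast_sum]
  push_cast
  rfl

/-- **Particle number from a key check**: if every key is an `N`-particle code, `φ_T` is an `N`-particle vector.
[cite: LinGubernatis1993, §II] -/
theorem isNParticle_vec {T : CoefTree} {N : ℕ}
    (hN : T.allKeys (fun m => decide (upCount (a * b) m + dnCount (a * b) m = N)) = true) :
    IsNParticle N (T.vec : Fock (Orb (Fin a ×ₗ Fin b))) := by
  refine UpperCert.isNParticle_codedVec T.get fun m _ => ?_
  by_cases hm : m ∈ T.keys
  · exact Or.inl (of_decide_eq_true (allKeys_spec hN m hm))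
  · exact Or.inr (get_eq_zero_of_not_mem hm)

/-! ### §3 Unit vectors, rational traces, orthonormal families -/

/-- The squared norm is the self pair product: `⟨φ_T, φ_T⟩ = T.nn`. [cite: LinGubernatis1993, §II] -/
theorem star_vec_dotProduct_self {T : CoefTree} (hB : T.isBST 0 (4 ^ (a * b)) = true) :
    star (T.vec : Fock (Orb (Fin a ×ₗ Fin b))) ⬝ᵥ T.vec = ((T.nn : ℤ) : ℂ) :=
  star_vec_dotProduct_vec hB T

/-- **The normalised tree vector** `φ_T/‖φ_T‖`. [cite: Ruelle1969, §3.3] -/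
noncomputable def unit (T : CoefTree) : Fock (Orb (Fin a ×ₗ Fin b)) :=
  ((Real.sqrt ((T.nn : ℝ))⁻¹ : ℝ) : ℂ) • T.vec

/-- The normalising factor squared is `1/T.nn`. [folklore] -/
private theorem sqrt_inv_sq {T : CoefTree} (hnn : 0 < T.nn) : (Real.sqrt ((T.nn : ℝ))⁻¹) ^ 2 = ((T.nn : ℝ))⁻¹ := by
  have h : (0 : ℝ) < (T.nn : ℝ) := by exact_mod_cast hnn
  rw [Real.sq_sqrt (inv_nonneg.2 h.le)]

/-- Pair products of normalised tree vectors. [cite: Ruelle1969, §3.3] -/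
theorem star_unit_dotProduct_unit' {T : CoefTree} (hB : T.isBST 0 (4 ^ (a * b)) = true) (U : CoefTree) :
    star (T.unit : Fock (Orb (Fin a ×ₗ Fin b))) ⬝ᵥ U.unit =
      ((Real.sqrt ((T.nn : ℝ))⁻¹ * Real.sqrt ((U.nn : ℝ))⁻¹ : ℝ) : ℂ) * ((T.dot U : ℤ) : ℂ) := by
  rw [unit, unit, star_smul, smul_dotProduct, dotProduct_smul, star_vec_dotProduct_vec hB U]
  simp only [smul_eq_mul, RCLike.star_def, Complex.conj_ofReal]
  push_cast
  ring

/-- **A checked tree vector with positive norm normalises exactly**: `⟨T.unit, T.unit⟩ = 1`. [cite: Ruelle1969, §3.3] -/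
theorem star_unit_dotProduct_unit {T : CoefTree} (hB : T.isBST 0 (4 ^ (a * b)) = true) (hnn : 0 < T.nn) :
    star (T.unit : Fock (Orb (Fin a ×ₗ Fin b))) ⬝ᵥ T.unit = 1 := by
  rw [star_unit_dotProduct_unit' hB T, ← pow_two, sqrt_inv_sq hnn]
  have h : (T.nn : ℂ) ≠ 0 := by exact_mod_cast hnn.ne'
  rw [show T.dot T = T.nn from rfl]
  push_cast
  exact inv_mul_cancel₀ h

/-- **Vanishing integer pair product ⇒ exactly orthogonal unit vectors.** [cite: Ruelle1969, §3.3] -/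
theorem star_unit_dotProduct_unit_eq_zero {T U : CoefTree} (hB : T.isBST 0 (4 ^ (a * b)) = true) (h0 : T.dot U = 0) :
    star (T.unit : Fock (Orb (Fin a ×ₗ Fin b))) ⬝ᵥ U.unit = 0 := by
  rw [star_unit_dotProduct_unit' hB U, h0]
  simp

/-- **THE RATIONAL TRACE OF A UNIT TREE VECTOR**: if `O.Models a b hz Q H` and `T` is a checked tree with
`T.nn > 0`, then `Re⟨T.unit, H T.unit⟩ = T.sApp O / (Q·T.nn)`. [cite: Ruelle1969, §3.3] [cite: LinGubernatis1993, §II] -/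
theorem re_star_unit_dotProduct_mulVec_unit {O : CodedCluster} {hz : ℕ → ℕ → ℤ} {Q : ℕ}
    {H : Matrix (Finset (Orb (Fin a ×ₗ Fin b))) (Finset (Orb (Fin a ×ₗ Fin b))) ℂ} (hM : O.Models a b hz Q H)
    {T : CoefTree} (hB : T.isBST 0 (4 ^ (a * b)) = true) (hnn : 0 < T.nn) :
    (star (T.unit : Fock (Orb (Fin a ×ₗ Fin b))) ⬝ᵥ (H *ᵥ T.unit)).re = (T.sApp O : ℝ) / ((Q : ℝ) * (T.nn : ℝ)) := by
  rw [unit, star_smul, mulVec_smul, smul_dotProduct, dotProduct_smul, star_vec_dotProduct_mulVec hM hB]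
  simp only [smul_eq_mul, RCLike.star_def, Complex.conj_ofReal]
  have hc : ((Real.sqrt ((T.nn : ℝ))⁻¹ : ℝ) : ℂ) * (((Real.sqrt ((T.nn : ℝ))⁻¹ : ℝ) : ℂ) *
      ((((T.sApp O : ℤ) : ℝ) : ℂ) / ((Q : ℝ) : ℂ))) =
      (((Real.sqrt ((T.nn : ℝ))⁻¹) ^ 2 * ((T.sApp O : ℤ) : ℝ) / (Q : ℝ) : ℝ) : ℂ) := by
    push_cast; ring
  rw [hc, Complex.ofReal_re, sqrt_inv_sq hnn, inv_mul_eq_div, div_div, mul_comm (T.nn : ℝ)]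

/-- The normalised vector keeps the particle number. [cite: Ruelle1969, §3.3] -/
theorem isNParticle_unit {T : CoefTree} {N : ℕ}
    (hN : T.allKeys (fun m => decide (upCount (a * b) m + dnCount (a * b) m = N)) = true) :
    IsNParticle N (T.unit : Fock (Orb (Fin a ×ₗ Fin b))) := by
  intro s hs
  simp [unit, isNParticle_vec hN s hs]

/-- **EXACTLY ORTHONORMAL FAMILIES FROM CHECKED TREES**: positive norms and vanishing pair products between distinct
members give `⟨φ_i, φ_j⟩ = δ_ij` for the unit vectors — the hypothesis of the Rayleigh-family (Peierls) floors.
[cite: Ruelle1969, §3.3] -/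
theorem orthonormal_units {ι : Type*} [DecidableEq ι] (T : ι → CoefTree) (hB : ∀ i, (T i).isBST 0 (4 ^ (a * b)) = true)
    (hnn : ∀ i, 0 < (T i).nn) (hdot : ∀ i j, i ≠ j → (T i).dot (T j) = 0) (i j : ι) :
    star ((T i).unit : Fock (Orb (Fin a ×ₗ Fin b))) ⬝ᵥ (T j).unit = if i = j then 1 else 0 := by
  by_cases h : i = j
  · subst h
    rw [if_pos rfl, star_unit_dotProduct_unit (hB i) (hnn i)]
  · rw [if_neg h, star_unit_dotProduct_unit_eq_zero (hB i) (hdot i j h)]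

end Box

end CoefTree

end OccupationCode

end Literature.MathematicalPhysics.QuantumLattice
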